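import Summits.BirchSwinnertonDyer.BirchSwinnertonDyer.Theorems.TwoAdicConverseOrdLambdaHalfAtTwoBDPTwoVariableDefs
import Summits.BirchSwinnertonDyer.BirchSwinnertonDyer.Theorems.TwoAdicConverseBDPSelmerLowerDivisibilityAtTwoGaussContent
import Summits.BirchSwinnertonDyer.BirchSwinnertonDyer.Theorems.TwoAdicConverseBDPSelmerLowerDivisibilityAtTwoCharIdealPrincipal
import Summits.BirchSwinnertonDyer.BirchSwinnertonDyer.Theorems.TwoAdicConverseBDPSelmerLowerDivisibilityAtTwoPrimePinning
import HarnessLib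

/-!
# Line `trivial_character_order_two` — MULT₀: pin the cofactor by the RESIDUAL ORDER OF VANISHING AT THE TRIVIAL CHARACTER
# (crux idea seat 1, GEN 5, lens `wuc` at crux level; crux O2 `BDPSelmerLowerDivisibilityAtTwo`, stmt-BirchSwinnertonDyer-24728)

NOT the line of record (that is v5 `two_variable_gv_squeeze_two`, sha16 43caa833da619033, single registration slot, lead's);
this file is seat 1's typed idea NODE for O2, published under `Cruxes/BDPSelmerLowerDivisibilityAtTwo/Lines/` and NOT
registered (`ledger skeleton check` is the lead's verb).  Frame decls `A₂ Ω₂ red₂ O2Goal`, U, P0, R0T, CONTENT are restated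
VERBATIM from the v5 mirror `Cruxes/OrdLambdaHalfAtTwo/Lines/kato_determinant_greenberg_two_O2_gv_squeeze_v4.lean`
(nobody imports a Lines module); the kernel pieces are cited BY NAME (p766476 `…CharIdealPrincipal`, p768124 `…PrimePinning`,
p766427 `…GaussContent`).

## The lever (one object): `m₀(F) := ord_𝔪 (red F)`, the order of vanishing of the special fibre `red F ∈ 𝔽̄₂⟦T₁,T₂⟧` at its
closed point = the TRIVIAL CHARACTER 𝟙 (the Hilbert–Samuel order; `m₀ ≥` Cuoco–Monsky's generic `l₀`, which counts only the
rational-line factors `(γ-1)`).  MULT₀ = `OrderPinned G C'`: for the primitive part `C₁` of the algebraic generator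
(`C' = 2^a C₁`, `red C₁ ≠ 0`) SOME `k` has  JET_k `red G ∉ 𝔪^{k+1}` (a UNIT among the Taylor coefficients of `G` at 𝟙 of
total degree `≤ k` — ANALYTIC, an upper bound on an order of vanishing) and GROWTH_k `red C₁ ∈ 𝔪^k` (ALGEBRAIC, a lower
bound on the residual multiplicity of `ch X_Gr` at 𝟙).  KERNEL `span_le_span_of_order_pin` (§1, sorry-free, ~40 lines, NO
Krull / Noetherian input): U's slack `2^m G = 2^a C₁ h` + `red C₁ ≠ 0` + JET_k + GROWTH_k ⟹ `(2^a C₁) ⊆ (G)` — because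
`G = C₁ h₀` (Gauss content) and a NON-unit `red h₀ ∈ 𝔪` would push `red G = red C₁ · red h₀` into `𝔪^k·𝔪 = 𝔪^{k+1}`.
No prime `𝔓`, no line, no control-to-a-line, no residual divisor EQUALITY, no `v₂` of any VALUE: only two INEQUALITIES
between vanishing orders (`m₀(red G) ≤ k ≤ m₀(red C₁)`), i.e. ord SUPERADDITIVITY.

## NODE  `O2 ⟸ P0[kernel] ∧ ORDPIN[kernel, here] ∧ CONTENT[kernel] ∧ U[shared] ∧ R0T[shared] ∧ MULT₀[NEW]`
(`bdpSelmerLowerDivisibilityAtTwo_of_ordPieces`, sorry-free; composition `BDPSelmerLowerDivisibilityAtTwo_of` concludes O2 BY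
NAME; sorries EXACTLY `stub_upperInclusionRat` (U), `stub_frameTorsion` (R0T), `stub_trivialCharacterOrder` (MULT₀)).
RUNG (§5, sorry-free, NO U): `GreenbergFrameTorsionAt W K → GreenbergJet₀At W K → GreenbergLowerInclusionAt W K` — on a JET₀
row (`G(𝟙)` a 2-adic unit) `G` is a unit of `𝒪_{ℂ₂}⟦T₁,T₂⟧` and O2 is TRIVIAL; PRINT (Kriz–Li 2016 (trivcong)+Lemma 2.10 at
`p = 2`, ψ = 𝟙: `((3-a₂)/2)·log_ω y_K ≡ 0 mod 2𝒪_{ℂ₂}` whenever `2 ∤ N`, `d_K` odd `< -4`) says `v₂(𝓛^BDP(𝟙)) ≥ 2`, so JET₀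
rows need the frame normalisation exponent `d′ ≤ -2` (K-d′ audit) — the honest content of MULT₀ on (β) is `k ≥ 1`.
Second layer (prose, line card): JET_{k≥1} UNPRINTED at 2 (INSTRUMENTABLE-hard: `m₀(red G) ≤ λ(G|_𝔓)` for any line with
`μ = 0`, e.g. `2λ(ℒ₂^BDP,ac)` via 2-power-conductor Heegner logs); GROWTH_k ⟸ (G1) trivial-character GL(1) classes with the Katz
trivial zero (ATTACKABLE) ∧ (G2) pseudo-null control of `X_Gr` at 𝟙 (IDEA-NEEDED, `IwasawaTheoryAtTwo`-adjacent).

Nothing about any elliptic curve is asserted beyond the three research sorries; O2, 19556, 19218 stay OPEN; BSD is proved for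
no curve; typed ≠ proved.  BANNED OPTION not used.  References: [folklore] (local rings, Gauss content over a rank-one valuation
ring); Cuoco–Monsky, Math. Ann. 255 (1981) (doi:10.1007/bf01450674) `l₀, m₀` [locator corpus:paper:arxiv-2606.03579 p5 Def 2.2 /
Thm 2.3]; Kriz–Li, arXiv:1609.06687 §2.9 (trivcong), Lemma 2.10, Remark 2.3 [corpus p12 L10–59, p7 L52].
-/

-- D-0017: single-problem summit, the namespace repeats the problem name by design.
set_option linter.dupNamespace false
set_option autoImplicit false

noncomputable section

open scoped Classical NumberField
open WeierstrassCurve NumberField IsDedekindDomain Field Function PowerSeries CongruenceSubgroup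
open Literature.NumberTheory.EllipticCurves Literature.NumberTheory.EllipticCurves.Rank1Residual
open Literature.NumberTheory.EllipticCurves.ModularForms
open Literature.NumberTheory.GaloisRepresentations
open Literature.NumberTheory.EllipticCurves.IwasawaAlgebra₂ Literature.NumberTheory.EllipticCurves.UnrSeries₂
open Literature.NumberTheory.EllipticCurves.YanZhu2026
open Summit.BirchSwinnertonDyer.BirchSwinnertonDyer.Theorems.TwoAdicKatoDeterminant
open Summit.BirchSwinnertonDyer.BirchSwinnertonDyer.Theorems.TwoAdicBDPGaussContent
open Summit.BirchSwinnertonDyer.BirchSwinnertonDyer.Theorems.TwoAdicBDPPrimePinning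

namespace Summit.BirchSwinnertonDyer.BirchSwinnertonDyer.Cruxes.BDPSelmerLowerDivisibilityAtTwo.TrivialCharacterOrderTwo

/-! ## §0 Frame (verbatim from the v5 mirror) -/

/-- `A = 𝒪_{ℂ₂}⟦T₁⟧⟦T₂⟧`, the value ring of O2's frame (verbatim v5). -/
abbrev A₂ : Type := PowerSeries (PowerSeries (PadicComplexInt 2))

/-- `Ω = 𝔽̄₂⟦T₁⟧⟦T₂⟧`, the special fibre (verbatim v5); a LOCAL ring whose closed point is the trivial character 𝟙. -/
abbrev Ω₂ : Type := PowerSeries (PowerSeries (IsLocalRing.ResidueField (PadicComplexInt 2)))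

/-- Reduction modulo `𝔪_{𝒪_{ℂ₂}}` on coefficients (verbatim v5). -/
def red₂ : A₂ →+* Ω₂ := PowerSeries.map (PowerSeries.map (IsLocalRing.residue (PadicComplexInt 2)))

/-- The maximal ideal `𝔪 = (𝔪_{𝔽̄₂}, T₁, T₂) = (T₁, T₂)` of the special fibre: `red F ∈ 𝔪^k` iff every Taylor coefficient of
`F` at 𝟙 of total degree `< k` lies in `𝔪_{𝒪_{ℂ₂}}`; `m₀(F) = sup {k : red F ∈ 𝔪^k}`. -/
abbrev 𝔪Ω : Ideal Ω₂ := IsLocalRing.maximalIdeal Ω₂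

/-- The crux, by name (reducible alias, verbatim v5). -/
abbrev O2Goal : Prop := BDPSelmerLowerDivisibilityAtTwo

/-! ## §1 KERNEL — pinning the cofactor by residual ORDER at the closed point (sorry-free) -/

/-- **MULT₀ for a pair `(G, C')`** — for every primitive part `C₁` of `C'` (`C' = 2^a·C₁`, `red C₁ ≠ 0`) SOME `k : ℕ` carries
JET_k `red G ∉ 𝔪^{k+1}` (`m₀(G) ≤ k`) and GROWTH_k `red C₁ ∈ 𝔪^k` (`m₀(C₁) ≥ k`).  Equivalently `m₀(red G) ≤ m₀(red C₁)`
with `m₀(red G) < ∞`.  No prime, no line, no equality. -/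
def OrderPinned (G C' : A₂) : Prop :=
  ∀ (a : ℕ) (C₁ : A₂), C' = (2 : A₂) ^ a * C₁ → red₂ C₁ ≠ 0 →
    ∃ k : ℕ, red₂ G ∉ 𝔪Ω ^ (k + 1) ∧ red₂ C₁ ∈ 𝔪Ω ^ k

/-- **ORDPIN** (kernel algebra, proved below): `2^m·G = 2^a·C₁·h`, `red C₁ ≠ 0`, JET_k, GROWTH_k ⟹ `(2^a·C₁) ⊆ (G)`. -/
def OrderPinning₂ : Prop :=
  ∀ (C₁ G h : A₂) (a m k : ℕ),
    (2 : A₂) ^ m * G = (2 : A₂) ^ a * C₁ * h → red₂ C₁ ≠ 0 → red₂ G ∉ 𝔪Ω ^ (k + 1) → red₂ C₁ ∈ 𝔪Ω ^ k →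
    Ideal.span {(2 : A₂) ^ a * C₁} ≤ Ideal.span {G}

variable {p : ℕ} [Fact p.Prime] in
/-- **ORDPIN, general prime, unfolded.**  In `A = 𝒪_{ℂ_p}⟦T₁⟧⟦T₂⟧` with `red = map (map residue)`: if `p^m·G = p^a·C₁·h`,
`red C₁ ≠ 0`, `red G ∉ 𝔪^{k+1}` and `red C₁ ∈ 𝔪^k` (𝔪 the maximal ideal of the local ring `𝔽̄_p⟦T₁⟧⟦T₂⟧`), then
`(p^a·C₁) ⊆ (G)`.  Proof: `a ≤ m` (else `red G = 0`); Gauss content (p766427) gives `h = p^{m-a}·h₀`, `G = C₁·h₀`; if `red h₀` is a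
unit then `h₀ ∈ Aˣ` (`isUnit_of_isUnit_map_map_residue`) and we are done; else `red h₀ ∈ 𝔪` and
`red G = red C₁ · red h₀ ∈ 𝔪^k · 𝔪 = 𝔪^{k+1}`, contradicting JET_k. [folklore] -/
theorem span_le_span_of_order_pin (C₁ G h : PowerSeries (PowerSeries (PadicComplexInt p))) (a m k : ℕ)
    (hGCh : ((p : ℕ) : PowerSeries (PowerSeries (PadicComplexInt p))) ^ m * G =
      ((p : ℕ) : PowerSeries (PowerSeries (PadicComplexInt p))) ^ a * C₁ * h)
    (hC₁ : PowerSeries.map (PowerSeries.map (IsLocalRing.residue (PadicComplexInt p))) C₁ ≠ 0)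
    (hJet : PowerSeries.map (PowerSeries.map (IsLocalRing.residue (PadicComplexInt p))) G ∉
      IsLocalRing.maximalIdeal (PowerSeries (PowerSeries (IsLocalRing.ResidueField (PadicComplexInt p)))) ^ (k + 1))
    (hGrowth : PowerSeries.map (PowerSeries.map (IsLocalRing.residue (PadicComplexInt p))) C₁ ∈
      IsLocalRing.maximalIdeal (PowerSeries (PowerSeries (IsLocalRing.ResidueField (PadicComplexInt p)))) ^ k) :
    Ideal.span {((p : ℕ) : PowerSeries (PowerSeries (PadicComplexInt p))) ^ a * C₁} ≤ Ideal.span {G} := by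
  set red := PowerSeries.map (PowerSeries.map (IsLocalRing.residue (PadicComplexInt p))) with hred
  set P : PowerSeries (PowerSeries (PadicComplexInt p)) := ((p : ℕ) : PowerSeries (PowerSeries (PadicComplexInt p)))
    with hP
  have hredP : red P = 0 := map_map_residue_natCast_prime
  rcases Nat.lt_or_ge m a with hma | ham
  · -- `m < a`: then `G = p·(…)`, so `red G = 0 ∈ 𝔪^{k+1}`, contradicting JET_k
    obtain ⟨n, rfl⟩ : ∃ n, a = m + (n + 1) := ⟨a - m - 1, by omega⟩
    have h1 : G = P ^ (n + 1) * C₁ * h := by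
      refine mul_left_cancel₀ (natCast_prime_pow_ne_zero (p := p) m) ?_
      rw [hGCh, pow_add]; ring
    have h0 : red G = 0 := by
      rw [h1, map_mul, map_mul, map_pow, hredP, zero_pow (Nat.succ_ne_zero n), zero_mul, zero_mul]
    exact absurd (show red G ∈ _ by rw [h0]; exact Ideal.zero_mem _) hJet
  · -- `a ≤ m`: cancel `p^a`, then Gauss content for the constant `p^(m-a)`
    obtain ⟨n, rfl⟩ := Nat.exists_eq_add_of_le ham
    have h1 : P ^ n * G = C₁ * h := by
      refine mul_left_cancel₀ (natCast_prime_pow_ne_zero (p := p) a) ?_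
      rw [← mul_assoc, ← pow_add, hGCh, mul_assoc]
    have hC₁u : ∃ i : ℕ × ℕ, IsUnit (coeff i.2 (coeff i.1 C₁)) :=
      exists_isUnit_coeff_of_map_map_residue_ne_zero hC₁
    have hdvd : PowerSeries.C (PowerSeries.C (((p : ℕ) : PadicComplexInt p) ^ n)) ∣ C₁ * h :=
      ⟨G, by rw [← h1, hP, natCast_pow_eq_C_C]⟩
    obtain ⟨h₀, rfl⟩ := C_C_dvd_of_C_C_dvd_mul_of_exists_isUnit_coeff hC₁u hdvd
    have hG : G = C₁ * h₀ := by
      refine mul_left_cancel₀ (natCast_prime_pow_ne_zero (p := p) n) ?_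
      rw [← hP, h1, hP, natCast_pow_eq_C_C]; ring
    have hGred : red G = red C₁ * red h₀ := by rw [hG, map_mul]
    by_cases hu0 : IsUnit (red h₀)
    · -- the cofactor is a residual unit, hence a unit: `(p^a C₁) = p^a u⁻¹ G`
      obtain ⟨u, hu⟩ := isUnit_of_isUnit_map_map_residue hu0
      refine Ideal.span_singleton_le_span_singleton.mpr ⟨↑u⁻¹ * P ^ a, ?_⟩
      rw [hG, ← hu, mul_assoc, Units.mul_inv_cancel_left, mul_comm]
    · -- a NON-unit cofactor raises the residual order: `red G ∈ 𝔪^k · 𝔪 = 𝔪^{k+1}`, contradicting JET_k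
      have hmax : red h₀ ∈
          IsLocalRing.maximalIdeal (PowerSeries (PowerSeries (IsLocalRing.ResidueField (PadicComplexInt p)))) :=
        (IsLocalRing.mem_maximalIdeal _).mpr (mem_nonunits_iff.mpr hu0)
      have hmem : red G ∈
          IsLocalRing.maximalIdeal (PowerSeries (PowerSeries (IsLocalRing.ResidueField (PadicComplexInt p)))) ^ (k + 1) := by
        rw [hGred, pow_succ]
        exact Ideal.mul_mem_mul hGrowth hmax
      exact absurd hmem hJet

/-- `p = 2` literal form of ORDPIN. [folklore] -/
theorem span_le_span_of_order_pin_two (C₁ G h : A₂) (a m k : ℕ)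
    (hGCh : (2 : A₂) ^ m * G = (2 : A₂) ^ a * C₁ * h) (hC₁ : red₂ C₁ ≠ 0)
    (hJet : red₂ G ∉ 𝔪Ω ^ (k + 1)) (hGrowth : red₂ C₁ ∈ 𝔪Ω ^ k) :
    Ideal.span {(2 : A₂) ^ a * C₁} ≤ Ideal.span {G} := by
  have h := span_le_span_of_order_pin (p := 2) C₁ G h a m k (by rw [Nat.cast_ofNat]; exact hGCh) hC₁ hJet hGrowth
  rwa [Nat.cast_ofNat] at h

/-- **ORDPIN holds** (kernel). -/
theorem orderPinning₂_holds : OrderPinning₂ :=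
  fun C₁ G h a m k h₁ h₂ h₃ h₄ => span_le_span_of_order_pin_two C₁ G h a m k h₁ h₂ h₃ h₄

/-- **JET₀ ⟹ unit**: if `red G ∉ 𝔪` (the VALUE `G(𝟙)` is a 2-adic unit) then `G ∈ Aˣ`, so `(x) ⊆ (G)` for every `x` —
O2's inclusion is TRIVIAL on such a frame datum. [folklore] -/
theorem span_le_span_of_jet₀ (G x : A₂) (hJet : red₂ G ∉ 𝔪Ω) : Ideal.span {x} ≤ Ideal.span {G} := by
  have hu : IsUnit (red₂ G) := by
    by_contra hnu
    exact hJet ((IsLocalRing.mem_maximalIdeal _).mpr (mem_nonunits_iff.mpr hnu))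
  obtain ⟨u, hu⟩ := isUnit_of_isUnit_map_map_residue (p := 2) hu
  rw [← hu, Ideal.span_singleton_eq_top.mpr u.isUnit]
  exact le_top

/-- JET₀ is the `k = 0` instance of MULT₀ (GROWTH₀ is vacuous: `𝔪^0 = ⊤`). -/
theorem orderPinned_of_jet₀ (G C' : A₂) (hJet : red₂ G ∉ 𝔪Ω) : OrderPinned G C' :=
  fun _ C₁ _ _ => ⟨0, by rwa [zero_add, pow_one], by rw [pow_zero, Ideal.one_eq_top]; exact Submodule.mem_top⟩

/-! ## §2 The shared pieces at a datum `(W, K)` and on the habitat (β) — VERBATIM from the v5 mirror -/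

/-- **U at `(E,K)`** (verbatim v5) — the Euler-system-directional (UPPER) inclusion at `2` with `2`-power slack, for EVERY
admissible frame datum: `ch_{Λ_K}(X_Gr(E/K̃_∞))·𝒪_{ℂ₂}⟦T₁,T₂⟧ ∣ 2^m · G`. -/
def GreenbergUpperInclusionRatAt (W : WeierstrassCurve ℚ) [W.IsElliptic] [W.IsGloballyMinimal]
    (K : Type) [Field K] [NumberField K] : Prop :=
  ∀ [IsCMField K] (ι : PadicAlgCl 2 ≃+* ℂ) (v vbar : HeightOneSpectrum (𝓞 K)) (κ₁ κ₂ : ZpExtension K 2)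
    (γ₁ γ₂ : absoluteGaloisGroup K) [Fact (ZpExtension.IsTopGeneratorPair κ₁ κ₂ γ₁ γ₂)]
    [NeZero (W.conductorNorm ℤ)] (f : CuspForm (Gamma0 (W.conductorNorm ℤ)) 2),
    ModularForms.IsNewformOf W f → ∀ [NeZero (NumberField.discr K).natAbs],
    ((2 : ℕ) : 𝓞 K) ∈ v.asIdeal → ((2 : ℕ) : 𝓞 K) ∈ vbar.asIdeal → vbar ≠ v →
    (∀ (w : InfinitePlace K) (k : 𝓞 K), k ∈ v.asIdeal ↔ ‖ι.symm (w.embedding (k : K))‖ < 1) →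
    ∀ (Ω δ : ℂ) (Ωp : (unrIntegers 2)ˣ) (LK G : A₂),
      Ω ≠ 0 → (δ ^ 2 = (NumberField.discr K : ℂ) ∨ δ ^ 2 = -(NumberField.discr K : ℂ)) →
      IsKatzMeasure₂ ι v vbar ∅ κ₁ κ₂ γ₁⁻¹ γ₂⁻¹ 1 Ω δ ((Ωp : unrIntegers 2) : ℂ_[2]) LK →
      IsGreenbergLFunctionFree₂ ι v vbar κ₁ κ₂ γ₁⁻¹ γ₂⁻¹ f (NumberField.discr K).natAbs
        (NumberField.classNumber K) LK G →
      ∀ J : ℤ_[2] →+* PadicComplexInt 2,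
        (∀ x : ℤ_[2], ((J x : PadicComplexInt 2) : ℂ_[2]) = ((x : ℚ_[2]) : ℂ_[2])) →
        ∃ m : ℕ, Ideal.span {(2 : A₂) ^ m * G} ≤
          (WeierstrassCurve.XGr₂.charIdeal (W.baseChange K) 2 κ₁ κ₂ vbar γ₁ γ₂).map (toUnr₂ 2 J)

/-- **P0 at `(E,K)`** (verbatim v5) — principality of `ch_{Λ_K}(X_Gr)` (kernel, p766476). -/
def XGr₂CharIdealPrincipalAt (W : WeierstrassCurve ℚ) [W.IsElliptic] [W.IsGloballyMinimal]
    (K : Type) [Field K] [NumberField K] : Prop :=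
  ∀ (vbar : HeightOneSpectrum (𝓞 K)) (κ₁ κ₂ : ZpExtension K 2) (γ₁ γ₂ : absoluteGaloisGroup K)
    [Fact (ZpExtension.IsTopGeneratorPair κ₁ κ₂ γ₁ γ₂)],
    Module.IsTorsion (IwasawaAlgebra₂ 2) ((W.baseChange K).XGr₂ 2 κ₁ κ₂ vbar γ₁ γ₂) →
    ∃ C : IwasawaAlgebra₂ 2, WeierstrassCurve.XGr₂.charIdeal (W.baseChange K) 2 κ₁ κ₂ vbar γ₁ γ₂ = Ideal.span {C}

/-- **R0T at `(E,K)`** (verbatim v5) — an admissible frame datum `(Ω, δ, Ωp, LK, G)` exists at `2` and `X_Gr(E/K̃_∞)` is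
`Λ_K`-torsion (O2's own `∃`-frame plus its torsion conjunct). -/
def GreenbergFrameTorsionAt (W : WeierstrassCurve ℚ) [W.IsElliptic] [W.IsGloballyMinimal]
    (K : Type) [Field K] [NumberField K] : Prop :=
  ∀ [IsCMField K] (ι : PadicAlgCl 2 ≃+* ℂ) (v vbar : HeightOneSpectrum (𝓞 K)) (κ₁ κ₂ : ZpExtension K 2)
    (γ₁ γ₂ : absoluteGaloisGroup K) [Fact (ZpExtension.IsTopGeneratorPair κ₁ κ₂ γ₁ γ₂)]
    [NeZero (W.conductorNorm ℤ)] (f : CuspForm (Gamma0 (W.conductorNorm ℤ)) 2),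
    ModularForms.IsNewformOf W f → ∀ [NeZero (NumberField.discr K).natAbs],
    ((2 : ℕ) : 𝓞 K) ∈ v.asIdeal → ((2 : ℕ) : 𝓞 K) ∈ vbar.asIdeal → vbar ≠ v →
    (∀ (w : InfinitePlace K) (k : 𝓞 K), k ∈ v.asIdeal ↔ ‖ι.symm (w.embedding (k : K))‖ < 1) →
    ∃ (Ω δ : ℂ) (Ωp : (unrIntegers 2)ˣ) (LK G : A₂),
      Ω ≠ 0 ∧ (δ ^ 2 = (NumberField.discr K : ℂ) ∨ δ ^ 2 = -(NumberField.discr K : ℂ)) ∧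
      IsKatzMeasure₂ ι v vbar ∅ κ₁ κ₂ γ₁⁻¹ γ₂⁻¹ 1 Ω δ ((Ωp : unrIntegers 2) : ℂ_[2]) LK ∧
      IsGreenbergLFunctionFree₂ ι v vbar κ₁ κ₂ γ₁⁻¹ γ₂⁻¹ f (NumberField.discr K).natAbs
        (NumberField.classNumber K) LK G ∧
      Module.IsTorsion (IwasawaAlgebra₂ 2) ((W.baseChange K).XGr₂ 2 κ₁ κ₂ vbar γ₁ γ₂)

/-- U on the habitat (β) (verbatim v5).  Research grade, shared with the line of record. -/
def TwoVariableUpperInclusionRatAtTwo : Prop :=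
  ∀ (W : WeierstrassCurve ℚ) [W.IsElliptic] [W.IsGloballyMinimal],
    ¬ W.HasCM → GoodOrd W 2 → ¬ W.HasIrreducibleModPGaloisRep 2 →
    ∀ (K : Type) [Field K] [NumberField K],
      (IsImaginaryQuadratic K ∧ SatisfiesHeegnerHypothesis (2 * W.conductorNorm ℤ) K) →
      GreenbergUpperInclusionRatAt W K

/-- P0 on the habitat (verbatim v5; kernel). -/
def XGr₂CharIdealPrincipalAtTwo : Prop :=
  ∀ (W : WeierstrassCurve ℚ) [W.IsElliptic] [W.IsGloballyMinimal] (K : Type) [Field K] [NumberField K],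
    XGr₂CharIdealPrincipalAt W K

/-- R0T on the habitat (β) (verbatim v5).  Research grade, shared with the line of record. -/
def TwoVariableFrameTorsionAtTwo : Prop :=
  ∀ (W : WeierstrassCurve ℚ) [W.IsElliptic] [W.IsGloballyMinimal],
    ¬ W.HasCM → GoodOrd W 2 → ¬ W.HasIrreducibleModPGaloisRep 2 →
    ∀ (K : Type) [Field K] [NumberField K],
      (IsImaginaryQuadratic K ∧ SatisfiesHeegnerHypothesis (2 * W.conductorNorm ℤ) K) →
      GreenbergFrameTorsionAt W K

/-- **CONTENT** (verbatim v5; kernel, p768124): every nonzero `C₀ ∈ ℤ₂⟦T₁,T₂⟧` reads as `2^a·C₁` with `red C₁ ≠ 0`. -/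
def TwoContent₂ : Prop :=
  ∀ (J : ℤ_[2] →+* PadicComplexInt 2) (C₀ : IwasawaAlgebra₂ 2), C₀ ≠ 0 →
    ∃ (a : ℕ) (C₁ : A₂), toUnr₂ 2 J C₀ = (2 : A₂) ^ a * C₁ ∧ red₂ C₁ ≠ 0

/-! ## §3 MULT₀ — the NEW research receptacle (replaces ACPIN's prime `𝔓` by the residual order at 𝟙) -/

/-- **MULT₀ at `(E,K)`** — for every admissible frame datum (the `∀`-frame of U), every structure map `J` and every generator
`C₀` of `ch_{Λ_K}(X_Gr(E/K̃_∞))`: `OrderPinned G (J C₀)`, i.e. `m₀(red G) ≤ m₀(red C₁) < ∞` for the primitive part `C₁` of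
`J C₀`: the special fibre of the Greenberg–BDP `L`-function vanishes at the trivial character to order AT MOST the residual
multiplicity of the (primitive) characteristic series of `X_Gr` there.  Content in prose (line card): JET_k — one unit Taylor
coefficient of `G` at 𝟙 in total degree `≤ k` (k = 0: `v₂(𝓛^BDP(𝟙)) + d′ = 0`, decided by HEEG2LOG + K-d′, EMPTY on (β) for
`d′ ≥ -1` by Kriz–Li (trivcong) at 2; k ≥ 1: UNPRINTED, instrumentable through one-line `λ`); GROWTH_k — the trivial-character
GL(1) classes with Katz's trivial zero (G1) modulo pseudo-null control of `X_Gr` at 𝟙 (G2, IDEA-NEEDED). -/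
def GreenbergOrderPinningAt (W : WeierstrassCurve ℚ) [W.IsElliptic] [W.IsGloballyMinimal]
    (K : Type) [Field K] [NumberField K] : Prop :=
  ∀ [IsCMField K] (ι : PadicAlgCl 2 ≃+* ℂ) (v vbar : HeightOneSpectrum (𝓞 K)) (κ₁ κ₂ : ZpExtension K 2)
    (γ₁ γ₂ : absoluteGaloisGroup K) [Fact (ZpExtension.IsTopGeneratorPair κ₁ κ₂ γ₁ γ₂)]
    [NeZero (W.conductorNorm ℤ)] (f : CuspForm (Gamma0 (W.conductorNorm ℤ)) 2),
    ModularForms.IsNewformOf W f → ∀ [NeZero (NumberField.discr K).natAbs],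
    ((2 : ℕ) : 𝓞 K) ∈ v.asIdeal → ((2 : ℕ) : 𝓞 K) ∈ vbar.asIdeal → vbar ≠ v →
    (∀ (w : InfinitePlace K) (k : 𝓞 K), k ∈ v.asIdeal ↔ ‖ι.symm (w.embedding (k : K))‖ < 1) →
    ∀ (Ω δ : ℂ) (Ωp : (unrIntegers 2)ˣ) (LK G : A₂),
      Ω ≠ 0 → (δ ^ 2 = (NumberField.discr K : ℂ) ∨ δ ^ 2 = -(NumberField.discr K : ℂ)) →
      IsKatzMeasure₂ ι v vbar ∅ κ₁ κ₂ γ₁⁻¹ γ₂⁻¹ 1 Ω δ ((Ωp : unrIntegers 2) : ℂ_[2]) LK →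
      IsGreenbergLFunctionFree₂ ι v vbar κ₁ κ₂ γ₁⁻¹ γ₂⁻¹ f (NumberField.discr K).natAbs
        (NumberField.classNumber K) LK G →
      ∀ J : ℤ_[2] →+* PadicComplexInt 2,
        (∀ x : ℤ_[2], ((J x : PadicComplexInt 2) : ℂ_[2]) = ((x : ℚ_[2]) : ℂ_[2])) →
        ∀ C₀ : IwasawaAlgebra₂ 2,
          WeierstrassCurve.XGr₂.charIdeal (W.baseChange K) 2 κ₁ κ₂ vbar γ₁ γ₂ = Ideal.span {C₀} →
          OrderPinned G (toUnr₂ 2 J C₀)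

/-- **MULT₀ on the habitat (β)** — the research stub replacing ACPIN / Rres in this node. -/
def TrivialCharacterOrderAtTwo : Prop :=
  ∀ (W : WeierstrassCurve ℚ) [W.IsElliptic] [W.IsGloballyMinimal],
    ¬ W.HasCM → GoodOrd W 2 → ¬ W.HasIrreducibleModPGaloisRep 2 →
    ∀ (K : Type) [Field K] [NumberField K],
      (IsImaginaryQuadratic K ∧ SatisfiesHeegnerHypothesis (2 * W.conductorNorm ℤ) K) →
      GreenbergOrderPinningAt W K

/-! ## §4 Stubs (P0, ORDPIN, CONTENT kernel BY NAME / proved here; research sorries EXACTLY U, R0T, MULT₀) -/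

/-- **stub P0** (kernel, by name from p766476). -/
theorem stub_charIdealPrincipal : XGr₂CharIdealPrincipalAtTwo :=
  fun W _ _ K _ _ vbar κ₁ κ₂ γ₁ γ₂ _ h =>
    Summit.BirchSwinnertonDyer.BirchSwinnertonDyer.Theorems.TwoAdicBDPCharIdealPrincipal.exists_xGr₂_charIdeal_eq_span_two
      W K vbar κ₁ κ₂ γ₁ γ₂ h

/-- **stub ORDPIN** (kernel, §1). -/
theorem stub_orderPinning : OrderPinning₂ := orderPinning₂_holds

/-- **stub CONTENT** (kernel, by name from p768124). -/
theorem stub_twoContent : TwoContent₂ :=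
  fun J C₀ hC₀ => exists_toUnr₂_eq_two_pow_mul_of_ne_zero J C₀ hC₀

/-- **stub U** (research, XL, SHARED verbatim with the line of record; `EulerSystemBigImageAtSmallImage`-adjacent, evaded by the
RATIONAL currency): two-variable Beilinson–Flach / BDP-reciprocity inclusion at `2` up to a power of `2`.  UNPRINTED at `p = 2`. -/
theorem stub_upperInclusionRat : TwoVariableUpperInclusionRatAtTwo := by
  sorry

/-- **stub R0T** (research, SHARED verbatim with the line of record): the frame `(Ω, δ, Ωp, LK, G)` exists at `2` and `X_Gr` is
`Λ_K`-torsion (R0G ∧ FINLINE₂/CTRL₂ per the line of record's annexes). -/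
theorem stub_frameTorsion : TwoVariableFrameTorsionAtTwo := by
  sorry

/-- **stub MULT₀** (research, NEW, the node's own receptacle): on habitat (β), for every admissible frame datum, every `J`, every
generator `C₀` of `ch(X_Gr)`: `OrderPinned G (toUnr₂ 2 J C₀)`.  Leaves: JET_k (analytic upper bound on `m₀(red G)`) and GROWTH_k
(algebraic lower bound on `m₀(red C₁)`), `k ≥ 1` on (β) by Kriz–Li at 2 unless `d′ ≤ -2`. -/
theorem stub_trivialCharacterOrder : TrivialCharacterOrderAtTwo := by
  sorry

/-! ## §5 THE NODE and the composition concluding O2 BY NAME -/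

/-- **THE NODE (MULT₀)** `O2 ⟸ P0 ∧ ORDPIN ∧ CONTENT ∧ U ∧ R0T ∧ MULT₀`, sorry-free.  Given the frame from R0T, a generator `C₀`
from P0, the slack `2^m G ∈ (J C₀)` from U, the content decomposition `J C₀ = 2^a C₁` from CONTENT and the common order `k`
from MULT₀, ORDPIN pins the cofactor: `(J C₀) ⊆ (G)`. -/
theorem bdpSelmerLowerDivisibilityAtTwo_of_ordPieces :
    XGr₂CharIdealPrincipalAtTwo → OrderPinning₂ → TwoContent₂ → TwoVariableUpperInclusionRatAtTwo →
      TwoVariableFrameTorsionAtTwo → TrivialCharacterOrderAtTwo → O2Goal := by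
  intro hP hPin hCt hU h0 hA W _ _ hCM hGO hβ K _ _ hK _ ι v vbar κ₁ κ₂ γ₁ γ₂ _ _ f hf _ hv hvbar hne hι
  obtain ⟨Ω, δ, Ωp, LK, G, hΩ, hδ, hLK, hG, htor⟩ :=
    h0 W hCM hGO hβ K hK ι v vbar κ₁ κ₂ γ₁ γ₂ f hf hv hvbar hne hι
  refine ⟨Ω, δ, Ωp, LK, G, hΩ, hδ, hLK, hG, htor, fun J hJ => ?_⟩
  obtain ⟨C₀, hC₀⟩ := hP W K vbar κ₁ κ₂ γ₁ γ₂ htor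
  obtain ⟨m, hm⟩ := hU W hCM hGO hβ K hK ι v vbar κ₁ κ₂ γ₁ γ₂ f hf hv hvbar hne hι Ω δ Ωp LK G hΩ hδ hLK hG J hJ
  have hO : OrderPinned G (toUnr₂ 2 J C₀) :=
    hA W hCM hGO hβ K hK ι v vbar κ₁ κ₂ γ₁ γ₂ f hf hv hvbar hne hι Ω δ Ωp LK G hΩ hδ hLK hG J hJ C₀ hC₀
  rw [hC₀, Ideal.map_span, Set.image_singleton] at hm ⊢
  obtain ⟨h, hh⟩ := Ideal.mem_span_singleton'.mp (hm (Ideal.mem_span_singleton_self _))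
  by_cases hC00 : C₀ = 0
  · rw [hC00, map_zero, Ideal.span_singleton_eq_bot.mpr rfl]
    exact bot_le
  · obtain ⟨a, C₁, haC₁, hC₁⟩ := hCt J C₀ hC00
    obtain ⟨k, hJet, hGrowth⟩ := hO a C₁ haC₁ hC₁
    rw [haC₁] at hh ⊢
    exact hPin C₁ G h a m k (by rw [← hh]; ring) hC₁ hJet hGrowth

/-- **THE COMPOSITION** — `O2` BY NAME from the stubs: `stub_charIdealPrincipal` (P0, kernel), `stub_orderPinning` (ORDPIN,
kernel), `stub_twoContent` (CONTENT, kernel), `stub_upperInclusionRat` (U), `stub_frameTorsion` (R0T), `stub_trivialCharacterOrder`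
(MULT₀); no sorry of its own. -/
theorem BDPSelmerLowerDivisibilityAtTwo_of : BDPSelmerLowerDivisibilityAtTwo :=
  bdpSelmerLowerDivisibilityAtTwo_of_ordPieces stub_charIdealPrincipal stub_orderPinning stub_twoContent stub_upperInclusionRat
    stub_frameTorsion stub_trivialCharacterOrder

/-! ## §6 RUNG `k = 0` (sorry-free, NO U): on a JET₀ datum O2 is trivial -/

/-- **JET₀ at `(E,K)`** — for every admissible frame datum, `red G ∉ 𝔪`: the VALUE of the Greenberg–BDP `L`-function at the
trivial character is a 2-adic UNIT in the frame's normalisation (`2·v₂(((3-a₂)/2)·log_ω y_K) + d′ = 0`).  INSTRUMENTABLE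
(HEEG2LOG + K-d′).  By Kriz–Li 2016 (trivcong) at `p = 2` this forces `d′ ≤ -2` on (β) (`d_K` odd `< -4`). -/
def GreenbergJet₀At (W : WeierstrassCurve ℚ) [W.IsElliptic] [W.IsGloballyMinimal]
    (K : Type) [Field K] [NumberField K] : Prop :=
  ∀ [IsCMField K] (ι : PadicAlgCl 2 ≃+* ℂ) (v vbar : HeightOneSpectrum (𝓞 K)) (κ₁ κ₂ : ZpExtension K 2)
    (γ₁ γ₂ : absoluteGaloisGroup K) [Fact (ZpExtension.IsTopGeneratorPair κ₁ κ₂ γ₁ γ₂)]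
    [NeZero (W.conductorNorm ℤ)] (f : CuspForm (Gamma0 (W.conductorNorm ℤ)) 2),
    ModularForms.IsNewformOf W f → ∀ [NeZero (NumberField.discr K).natAbs],
    ((2 : ℕ) : 𝓞 K) ∈ v.asIdeal → ((2 : ℕ) : 𝓞 K) ∈ vbar.asIdeal → vbar ≠ v →
    (∀ (w : InfinitePlace K) (k : 𝓞 K), k ∈ v.asIdeal ↔ ‖ι.symm (w.embedding (k : K))‖ < 1) →
    ∀ (Ω δ : ℂ) (Ωp : (unrIntegers 2)ˣ) (LK G : A₂),
      Ω ≠ 0 → (δ ^ 2 = (NumberField.discr K : ℂ) ∨ δ ^ 2 = -(NumberField.discr K : ℂ)) →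
      IsKatzMeasure₂ ι v vbar ∅ κ₁ κ₂ γ₁⁻¹ γ₂⁻¹ 1 Ω δ ((Ωp : unrIntegers 2) : ℂ_[2]) LK →
      IsGreenbergLFunctionFree₂ ι v vbar κ₁ κ₂ γ₁⁻¹ γ₂⁻¹ f (NumberField.discr K).natAbs
        (NumberField.classNumber K) LK G →
      red₂ G ∉ 𝔪Ω

/-- **RUNG (k = 0)**: `R0T-at ∧ JET₀-at ⟹ O2-at`, with NO Euler-system input and no `ch`-bookkeeping: the frame exists, `G` is a
unit, every ideal is `≤ (G) = ⊤`. -/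
theorem greenbergLowerInclusionAt_of_frameTorsion_of_jet₀ (W : WeierstrassCurve ℚ) [W.IsElliptic] [W.IsGloballyMinimal]
    (K : Type) [Field K] [NumberField K] (h0 : GreenbergFrameTorsionAt W K) (hJ : GreenbergJet₀At W K) :
    GreenbergLowerInclusionAt W K := by
  intro _ ι v vbar κ₁ κ₂ γ₁ γ₂ _ _ f hf _ hv hvbar hne hι
  obtain ⟨Ω, δ, Ωp, LK, G, hΩ, hδ, hLK, hG, htor⟩ := h0 ι v vbar κ₁ κ₂ γ₁ γ₂ f hf hv hvbar hne hι
  refine ⟨Ω, δ, Ωp, LK, G, hΩ, hδ, hLK, hG, htor, fun J _ => ?_⟩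
  have hu : IsUnit (red₂ G) := by
    by_contra hnu
    exact hJ ι v vbar κ₁ κ₂ γ₁ γ₂ f hf hv hvbar hne hι Ω δ Ωp LK G hΩ hδ hLK hG
      ((IsLocalRing.mem_maximalIdeal _).mpr (mem_nonunits_iff.mpr hnu))
  obtain ⟨u, hu⟩ := isUnit_of_isUnit_map_map_residue (p := 2) hu
  rw [← hu, Ideal.span_singleton_eq_top.mpr u.isUnit]
  exact le_top

/-- JET₀-at ⟹ MULT₀-at (the rung sits INSIDE the receptacle: `k = 0`, GROWTH₀ vacuous). -/
theorem greenbergOrderPinningAt_of_jet₀ (W : WeierstrassCurve ℚ) [W.IsElliptic] [W.IsGloballyMinimal]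
    (K : Type) [Field K] [NumberField K] (hJ : GreenbergJet₀At W K) : GreenbergOrderPinningAt W K :=
  fun ι v vbar κ₁ κ₂ γ₁ γ₂ _ _ f hf _ hv hvbar hne hι Ω δ Ωp LK G hΩ hδ hLK hG J _ C₀ _ =>
    orderPinned_of_jet₀ G (toUnr₂ 2 J C₀) (hJ ι v vbar κ₁ κ₂ γ₁ γ₂ f hf hv hvbar hne hι Ω δ Ωp LK G hΩ hδ hLK hG)

end Summit.BirchSwinnertonDyer.BirchSwinnertonDyer.Cruxes.BDPSelmerLowerDivisibilityAtTwo.TrivialCharacterOrderTwo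

end
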